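import Mathlib.Algebra.GroupWithZero.Defs
import Mathlib.Data.Set.Defs
import Mathlib.Order.Lattice
import Mathlib.Tactic.Ring
import HarnessLib

/-!
# Venture HSemireg — unit contraction for perturbation trees with edge operators

The algebraic half of the «CLAIM» of `widen/W1/UNITSPREAD-w1aut2.md` §1bis (computation cell
`pub-hsemireg`, seat w1-aut-2; read and re-proved by a different route by the squad's second-code
seat w1-tw-2, `widen/W1/USCHAIN-READ-tw2.md` §2, whose induction this file records).

Setting on paper (NOT in this file): in one slot of the harmonic tensor-SDR model, a summand of the
homological-perturbation formula for `m_N` is the value of a planar binary tree whose leaves carry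
harmonic classes `i(b)` (a UNIT leaf carries the constant function `1 = i(1)`), whose vertices
multiply, and whose edges carry one of the operators identity ∕ `Π = i p` ∕ `h`; the root carries
`p`. The analysis enters only through the side conditions `h i = 0`, `p h = 0`, `h h = 0` and their
consequences `Π i = i`, `Π h = 0`. The CLAIM: such a tree with `ν` non-unit leaves and `e` edges
carrying `h` evaluates to zero unless `e ≤ max(0, ν − 2)` — so the degree a slot can drop is bounded
by its NON-unit leaves, whatever the arity.

What is recorded here is that statement with the analysis replaced by its algebraic skeleton:

* `Op`, `PTree L` — edge operators and PLANTED trees (a planar binary tree each of whose subtrees,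
  leaves included, carries the operator of its top edge; non-unit leaves carry elements of the set
  `L` of leaf values); `PTree.nu` (number of non-unit leaves), `PTree.nh` (number of edges carrying
  `h`), `PTree.eval`;
* `OpData` — a `MulZeroOneClass` `A` (only `1 * a = a = a * 1` and `0 * a = 0 = a * 0` are used;
  no associativity, no additivity), maps `h P : A → A`, a root map `p : A → M`, and a set `L` of
  leaf values with `1 ∈ L`, `h ℓ = 0`, `P ℓ = ℓ` on `L`, `h (h a) = 0`, `P (h a) = 0`,
  `p (h a) = 0`, and `h 0 = 0`, `P 0 = 0`, `p 0 = 0`;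
* `Good` — the trichotomy invariant (an induction invariant of this file, `Prop`-valued) of a
  non-zero planted value: `ν = 0 ⇒` no `h` and value `1`; `ν = 1 ⇒` no `h` and value in `L`;
  `ν ≥ 2 ⇒ #h + 1 ≤ ν`, and `#h + 1 = ν ⇒` the value is `h`-headed; `good_one`, `good_leaf`,
  `good_mul`, `good_app` — leaves satisfy it and it survives a vertex and an edge operator;
* `eval_good` — every non-zero planted tree satisfies the invariant (structural induction);
* `unit_contraction` — **the CLAIM**: if `p (eval l * eval r) ≠ 0` for planted `l r` (the two
  children of the top vertex; the root edge carries `p`) then `nh l + nh r + 2 ≤ max 2 (nu l + nu r)`,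
  i.e. `e ≤ max(0, ν − 2)`; `unit_contraction_planted` — the planted bound `#h + 1 ≤ max 1 ν`;
  `term_eq_zero` — the contrapositive; `term_eq_zero_of_unit_leaf` — the strict-unitality shape
  (all `N − 2` internal edges carry `h`, one unit leaf, `N ≥ 3` ⇒ the summand vanishes).

The hypothesis `h ∘ Π = 0` of the note's four-case contraction proof is not needed on this route.

HONEST FRAMING. Finite trees over an abstract multiplicative structure with three operators; the
Lean index of one step of a MODEL-LEVEL necessary-condition filter used by the cell (the soundness of
that filter for the cell's first-order equation is a separate, hand-read question, `UNITSPREAD` §1ter).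
No category, sheaf, complex, differential form or abelian variety appears; nothing here says that HC,
HC_CM or HC_AV holds, and nothing here is a new case of anything.
-/

namespace Summit.Ventures.HSemireg

namespace UnitContraction

/-- The operator carried by an edge of a perturbation tree in one slot: identity, the projector
`Π = i p`, or the homotopy `h`. -/
inductive Op : Type
  | I : Op
  | P : Op
  | H : Op
  deriving DecidableEq

/-- The number of `h`'s an operator contributes (`1` for `H`, else `0`). -/
def Op.hcount : Op → ℕ
  | Op.H => 1
  | _ => 0

/-- The identity edge carries no `h`. -/
@[simp] theorem Op.hcount_I : Op.I.hcount = 0 := rfl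
/-- The projector edge carries no `h`. -/
@[simp] theorem Op.hcount_P : Op.P.hcount = 0 := rfl
/-- The homotopy edge carries one `h`. -/
@[simp] theorem Op.hcount_H : Op.H.hcount = 1 := rfl

/-- Planted planar binary trees whose non-unit leaves carry values in a set `L ⊆ A` of leaf values:
`unit o` is a unit leaf, `leaf o a` a non-unit leaf carrying `a ∈ L`, `node o l r` a vertex with
ordered children `l r`; in each case `o` is the operator on the TOP edge of that subtree. -/
inductive PTree {A : Type*} (L : Set A) : Type _
  | unit : Op → PTree L
  | leaf : Op → L → PTree L
  | node : Op → PTree L → PTree L → PTree L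

namespace PTree

variable {A : Type*} {L : Set A}

/-- Number of non-unit leaves. -/
def nu : PTree L → ℕ
  | unit _ => 0
  | leaf _ _ => 1
  | node _ l r => nu l + nu r

/-- Number of edges carrying the homotopy `h` (top edge included). -/
def nh : PTree L → ℕ
  | unit o => o.hcount
  | leaf o _ => o.hcount
  | node o l r => o.hcount + nh l + nh r

/-- A unit leaf has no non-unit leaf. -/
@[simp] theorem nu_unit (o : Op) : nu (unit o : PTree L) = 0 := rfl
/-- A non-unit leaf counts once. -/
@[simp] theorem nu_leaf (o : Op) (a : L) : nu (leaf o a : PTree L) = 1 := rfl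
/-- Non-unit leaves add over the children. -/
@[simp] theorem nu_node (o : Op) (l r : PTree L) : nu (node o l r) = nu l + nu r := rfl
/-- Homotopy count of a unit leaf = that of its edge. -/
@[simp] theorem nh_unit (o : Op) : nh (unit o : PTree L) = o.hcount := rfl
/-- Homotopy count of a non-unit leaf = that of its edge. -/
@[simp] theorem nh_leaf (o : Op) (a : L) : nh (leaf o a : PTree L) = o.hcount := rfl
/-- Homotopy count of a vertex = its edge plus the children. -/
@[simp] theorem nh_node (o : Op) (l r : PTree L) : nh (node o l r) = o.hcount + nh l + nh r := rfl

/-- Number of leaves (unit and non-unit). -/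
def leaves : PTree L → ℕ
  | unit _ => 1
  | leaf _ _ => 1
  | node _ l r => leaves l + leaves r

/-- A unit leaf is one leaf. -/
@[simp] theorem leaves_unit (o : Op) : leaves (unit o : PTree L) = 1 := rfl
/-- A non-unit leaf is one leaf. -/
@[simp] theorem leaves_leaf (o : Op) (a : L) : leaves (leaf o a : PTree L) = 1 := rfl
/-- Leaves add over the children. -/
@[simp] theorem leaves_node (o : Op) (l r : PTree L) :
    leaves (node o l r) = leaves l + leaves r := rfl

/-- There are at most as many non-unit leaves as leaves. -/
theorem nu_le_leaves : ∀ t : PTree L, t.nu ≤ t.leaves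
  | unit _ => by simp
  | leaf _ _ => by simp
  | node _ l r => by
    simp only [nu_node, leaves_node]
    exact Nat.add_le_add (nu_le_leaves l) (nu_le_leaves r)

/-- The single-leaf tree with the identity on its edge has no homotopy: the `N = 1` case of the
CLAIM, recorded for completeness. -/
theorem nh_leaf_I (a : L) : (leaf Op.I a : PTree L).nh = 0 := rfl

end PTree

/-- The algebraic skeleton of one slot of the tensor-SDR model: a multiplicative structure with the
homotopy `h`, the projector `P`, the root map `p` and the set `L` of leaf values (the harmonic
classes), subject to the side conditions actually used. -/
structure OpData (A : Type*) (M : Type*) [MulZeroOneClass A] [Zero M] where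
  /-- the homotopy on the top edge of a subtree -/
  h : A → A
  /-- the projector `Π = i p` -/
  P : A → A
  /-- the root map `p` -/
  p : A → M
  /-- the leaf values `i(H)` -/
  L : Set A
  one_mem : (1 : A) ∈ L
  h_zero : h 0 = 0
  P_zero : P 0 = 0
  p_zero : p 0 = 0
  h_leaf : ∀ a ∈ L, h a = 0
  P_leaf : ∀ a ∈ L, P a = a
  h_h : ∀ a, h (h a) = 0
  P_h : ∀ a, P (h a) = 0
  p_h : ∀ a, p (h a) = 0

variable {A : Type*} {M : Type*} [MulZeroOneClass A] [Zero M] (D : OpData A M)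

/-- Applying an edge operator. -/
def OpData.app : Op → A → A
  | Op.I, a => a
  | Op.P, a => D.P a
  | Op.H, a => D.h a

/-- The identity edge. -/
@[simp] theorem OpData.app_I (a : A) : D.app Op.I a = a := rfl
/-- The projector edge. -/
@[simp] theorem OpData.app_P (a : A) : D.app Op.P a = D.P a := rfl
/-- The homotopy edge. -/
@[simp] theorem OpData.app_H (a : A) : D.app Op.H a = D.h a := rfl

/-- Every edge operator sends `0` to `0`. -/
theorem OpData.app_zero (o : Op) : D.app o 0 = 0 := by
  cases o
  · rfl
  · exact D.P_zero
  · exact D.h_zero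

namespace PTree

/-- Bottom-up value of a planted tree: leaves, then products at vertices, then the top-edge
operator of each subtree. -/
def eval : PTree D.L → A
  | unit o => D.app o 1
  | leaf o a => D.app o (a : A)
  | node o l r => D.app o (eval l * eval r)

/-- Value of a unit leaf. -/
@[simp] theorem eval_unit (o : Op) : eval D (unit o) = D.app o 1 := rfl
/-- Value of a non-unit leaf. -/
@[simp] theorem eval_leaf (o : Op) (a : D.L) : eval D (leaf o a) = D.app o (a : A) := rfl
/-- Value of a vertex. -/
@[simp] theorem eval_node (o : Op) (l r : PTree D.L) :
    eval D (node o l r) = D.app o (eval D l * eval D r) := rfl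

end PTree

/-- The trichotomy invariant of a NON-ZERO planted value `v` with `ν` non-unit leaves and `H`
homotopy edges (an induction invariant of this file, not a cited statement): no non-unit leaf ⇒ no
`h` and `v = 1`; one ⇒ no `h` and `v ∈ L`; at least two ⇒ `H + 1 ≤ ν`, and in the extremal case
`H + 1 = ν` the value is `h`-headed. -/
def Good (ν H : ℕ) (v : A) : Prop :=
  (ν = 0 → H = 0 ∧ v = 1) ∧ (ν = 1 → H = 0 ∧ v ∈ D.L) ∧
    (2 ≤ ν → H + 1 ≤ ν ∧ (H + 1 = ν → ∃ a, v = D.h a))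

/-- A unit leaf before its edge operator: `Good D 0 0 1`. -/
theorem good_one : Good D 0 0 (1 : A) :=
  ⟨fun _ => ⟨rfl, rfl⟩, fun h => absurd h (by decide), fun h => absurd h (by decide)⟩

/-- A non-unit leaf before its edge operator: `Good D 1 0 a` for `a ∈ L`. -/
theorem good_leaf {a : A} (ha : a ∈ D.L) : Good D 1 0 a :=
  ⟨fun h => absurd h (by decide), fun _ => ⟨rfl, ha⟩, fun h => absurd h (by decide)⟩

/-- The invariant survives a vertex (product of two non-zero planted values). -/
theorem good_mul {ν₁ H₁ ν₂ H₂ : ℕ} {v₁ v₂ : A} (g₁ : Good D ν₁ H₁ v₁) (g₂ : Good D ν₂ H₂ v₂) :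
    Good D (ν₁ + ν₂) (H₁ + H₂) (v₁ * v₂) := by
  obtain ⟨a0, a1, a2⟩ := g₁
  obtain ⟨b0, b1, b2⟩ := g₂
  rcases Nat.lt_or_ge ν₁ 1 with h₁ | h₁
  · -- ν₁ = 0 : v₁ = 1, H₁ = 0
    obtain ⟨hH, hv⟩ := a0 (by omega)
    subst hH; subst hv
    have e1 : ν₁ = 0 := by omega
    subst e1
    simp only [one_mul, zero_add]
    exact ⟨b0, b1, b2⟩
  rcases Nat.lt_or_ge ν₂ 1 with h₂ | h₂
  · -- ν₂ = 0 : v₂ = 1, H₂ = 0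
    obtain ⟨hH, hv⟩ := b0 (by omega)
    subst hH; subst hv
    have e2 : ν₂ = 0 := by omega
    subst e2
    simp only [mul_one, add_zero]
    exact ⟨a0, a1, a2⟩
  -- both children have a non-unit leaf: the bound is strict, the extremal case is vacuous
  refine ⟨fun h => absurd h (by omega), fun h => absurd h (by omega), fun _ => ?_⟩
  have k₁ : H₁ + 1 ≤ ν₁ := by
    rcases Nat.lt_or_ge ν₁ 2 with l₁ | l₁
    · have := (a1 (by omega)).1; omega
    · exact (a2 l₁).1
  have k₂ : H₂ + 1 ≤ ν₂ := by
    rcases Nat.lt_or_ge ν₂ 2 with l₂ | l₂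
    · have := (b1 (by omega)).1; omega
    · exact (b2 l₂).1
  exact ⟨by omega, fun h => absurd h (by omega)⟩

/-- The invariant survives an edge operator, as long as the result is non-zero. -/
theorem good_app {ν H : ℕ} {v : A} (g : Good D ν H v) (o : Op) (hne : D.app o v ≠ 0) :
    Good D ν (o.hcount + H) (D.app o v) := by
  obtain ⟨g0, g1, g2⟩ := g
  cases o with
  | I =>
    simp only [Op.hcount_I, zero_add, OpData.app_I]
    exact ⟨g0, g1, g2⟩
  | P =>
    simp only [Op.hcount_P, zero_add, OpData.app_P] at hne ⊢
    refine ⟨fun h0 => ?_, fun h1 => ?_, fun h2 => ?_⟩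
    · obtain ⟨hH, hv⟩ := g0 h0
      exact ⟨hH, by rw [hv]; exact D.P_leaf 1 D.one_mem⟩
    · obtain ⟨hH, hv⟩ := g1 h1
      exact ⟨hH, by rw [D.P_leaf v hv]; exact hv⟩
    · obtain ⟨hle, hex⟩ := g2 h2
      refine ⟨hle, fun heq => ?_⟩
      obtain ⟨a, ha⟩ := hex heq
      exact absurd (by rw [ha]; exact D.P_h a) hne
  | H =>
    simp only [Op.hcount_H, OpData.app_H] at hne ⊢
    refine ⟨fun h0 => ?_, fun h1 => ?_, fun h2 => ?_⟩
    · obtain ⟨_, hv⟩ := g0 h0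
      exact absurd (by rw [hv]; exact D.h_leaf 1 D.one_mem) hne
    · obtain ⟨_, hv⟩ := g1 h1
      exact absurd (D.h_leaf v hv) hne
    · obtain ⟨hle, hex⟩ := g2 h2
      have hlt : H + 1 < ν := by
        rcases Nat.lt_or_ge (H + 1) ν with hlt | hge
        · exact hlt
        · obtain ⟨a, ha⟩ := hex (by omega)
          exact absurd (by rw [ha]; exact D.h_h a) hne
      exact ⟨by omega, fun _ => ⟨v, rfl⟩⟩

/-- **Trichotomy.** Every planted tree with leaf values in `L` and non-zero value satisfies the
invariant `Good D (nu t) (nh t) (eval t)`. -/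
theorem eval_good : ∀ t : PTree D.L, t.eval D ≠ 0 → Good D t.nu t.nh (t.eval D)
  | PTree.unit o, hne => by
    have := good_app D (good_one D) o (by simpa using hne)
    simpa using this
  | PTree.leaf o a, hne => by
    have := good_app D (good_leaf D a.2) o (by simpa using hne)
    simpa using this
  | PTree.node o l r, hne => by
    simp only [PTree.eval_node] at hne
    have hl0 : l.eval D ≠ 0 := by
      intro h0; apply hne; rw [h0, zero_mul]; exact D.app_zero o
    have hr0 : r.eval D ≠ 0 := by
      intro h0; apply hne; rw [h0, mul_zero]; exact D.app_zero o
    have g := good_app D (good_mul D (eval_good l hl0) (eval_good r hr0)) o hne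
    simp only [PTree.nu_node, PTree.nh_node, PTree.eval_node]
    have e : o.hcount + l.nh + r.nh = o.hcount + (l.nh + r.nh) := by ring
    rw [e]
    exact g

/-- The planted bound: a non-zero planted tree has `#h + 1 ≤ max 1 ν`, i.e. at most
`max(0, ν − 1)` homotopy edges. -/
theorem unit_contraction_planted (t : PTree D.L) (hne : t.eval D ≠ 0) :
    t.nh + 1 ≤ max 1 t.nu := by
  obtain ⟨g0, g1, g2⟩ := eval_good D t hne
  rcases Nat.lt_or_ge t.nu 2 with hlt | hge
  · rcases Nat.lt_or_ge t.nu 1 with h0 | h1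
    · have := (g0 (by omega)).1; omega
    · have := (g1 (by omega)).1; omega
  · have := (g2 hge).1; omega

/-- **The CLAIM (unit contraction).** For the two planted children `l r` of the top vertex of a
perturbation tree in one slot (the root edge carries `p`): if the term `p (eval l * eval r)` is
non-zero then the number `e = nh l + nh r` of homotopy edges satisfies `e + 2 ≤ max 2 ν`,
`ν = nu l + nu r` the number of non-unit leaves — i.e. `e ≤ max(0, ν − 2)`. -/
theorem unit_contraction (l r : PTree D.L) (hne : D.p (l.eval D * r.eval D) ≠ 0) :
    l.nh + r.nh + 2 ≤ max 2 (l.nu + r.nu) := by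
  have hl0 : l.eval D ≠ 0 := by
    intro h0; apply hne; rw [h0, zero_mul]; exact D.p_zero
  have hr0 : r.eval D ≠ 0 := by
    intro h0; apply hne; rw [h0, mul_zero]; exact D.p_zero
  obtain ⟨g0, g1, g2⟩ := good_mul D (eval_good D l hl0) (eval_good D r hr0)
  rcases Nat.lt_or_ge (l.nu + r.nu) 2 with hlt | hge
  · rcases Nat.lt_or_ge (l.nu + r.nu) 1 with h0 | h1
    · have := (g0 (by omega)).1; omega
    · have := (g1 (by omega)).1; omega
  · obtain ⟨hle, hex⟩ := g2 hge
    rcases Nat.lt_or_ge (l.nh + r.nh + 1) (l.nu + r.nu) with hlt | hge'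
    · omega
    · obtain ⟨a, ha⟩ := hex (by omega)
      exact absurd (by rw [ha]; exact D.p_h a) hne

/-- **The CLAIM, contrapositive form**: a perturbation-tree term whose homotopy count exceeds
`max(0, ν − 2)` vanishes. -/
theorem term_eq_zero (l r : PTree D.L) (h : max 2 (l.nu + r.nu) < l.nh + r.nh + 2) :
    D.p (l.eval D * r.eval D) = 0 := by
  by_contra hne
  exact absurd (unit_contraction D l r hne) (by omega)

/-- **Strict unitality of the one-slot transferred structure** (the shape of the fact, as used in
`UNITSPREAD` §1): in the one-slot perturbation formula EVERY internal edge carries `h`, so a tree with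
`N ≥ 3` leaves has `N − 2 ≥ 1` homotopies; if one of its leaves is a unit (`ν < N`) the term
vanishes — `m_N(…, 1, …) = 0` summand by summand. -/
theorem term_eq_zero_of_unit_leaf (l r : PTree D.L) (hN : 3 ≤ l.leaves + r.leaves)
    (hh : l.nh + r.nh + 2 = l.leaves + r.leaves) (hu : l.nu + r.nu < l.leaves + r.leaves) :
    D.p (l.eval D * r.eval D) = 0 :=
  term_eq_zero D l r (by omega)

end UnitContraction

end Summit.Ventures.HSemireg
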